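import Summits.BirchSwinnertonDyer.Rank1Residual.Additive.StrictSelmerIndex
import Summits.BirchSwinnertonDyer.Rank1Residual.Additive.QuadraticBranchOddStrictSelmerCertificate
import Mathlib.GroupTheory.PGroup
import Mathlib.GroupTheory.Perm.Cycle.Type
import HarnessLib

/-!
# The odd-`η`-branch strict bound ALSO bounds the `p`-divisibility LEVEL of the generator: with the
# index theorem (`#Sel_str = p^ν · #Ш[p^∞]`, p310832), a bottom-layer bound
# `ord_p #Sel_str(W/ℚ)[p^∞] ≤ v_p(coeff₁ L_p⁻(V, η, X))` gives `ν + ord_p #Ш(W)[p^∞] ≤ v_p(coeff₁)`,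
# and a UNIT certificate gives `ν = 0 ∧ Ш(W)[p^∞] = 0` — the generator is `p`-indivisible in
# `E(ℚ_p)` (cell `b2b-bsdres`, lane CLASS-CLOSURE, x1b GEN 30 = O10 class lead; class-agnostic
# bookkeeping over cc-typer-6's typed inputs p259634 §3 / certificate file; by x1b's RULING
# a8bd8e04d6a47657 the strict route is NOT an O10 route — the sharpened consumers serve the NON-CM
# twins O7-ss ∩ `e = 2` (cc-typer-2 / n1011), and the `ν = 0` prediction is an E1 CONSISTENCY statement)

HONEST FRAMING (cell `b2b-bsdres`, run/shared/lean/b2b/bsd-rank1-residual/, verbatim in every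
file): prove what is provable now; shrink each hard class to its core with data; no claim beyond
stated classes. Research routes; census output = EVIDENCE / conjecture items, never a Literature
fact; RESIDUAL-MAP marks change only by signed lines; nothing is booked; no label changes. THEOREMS
ONLY (arithmetic over the tree's theorems and cc-typer-6's TYPED inputs, which enter as explicit
hypotheses); NO definition, NO Literature fact, NO `sorry`; the classes served stay OPEN /
CONSTRUCTION-SHAPED.

## What
For `W/ℚ`, `p` prime, `P ∈ W(ℚ)` of infinite order generating `W(ℚ)` mod torsion, `W(ℚ_p)[p] = 0`,
and `n` the exact `p`-divisibility level of `P` in `W(ℚ_p)`: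
* `not_dvd_torsionOrder_of_noPTorsion` / `padicValRat_tamagawaProduct_div_torsionOrder_sq`:
  `W(ℚ_p)[p] = 0 ⟹ p ∤ #W(ℚ)_tors`, so `ord_p(Tam/#tors²) = ord_p Tam` (the (C3_η) exponent).
* `finite_shaPrimary_of_finite_strictSelmerPInfty`: `Sel_str(W/ℚ)[p^∞]` finite ⟹ `Ш(W)[p^∞]`
  finite (index theorem: `#Sel_str = pⁿ·#Ш[p^∞]`, and a finite group has `Nat.card ≠ 0`) — NO GZK.
* `level_add_padicValNat_card_sha_le_of_bound`: the OUTPUT of a bottom-layer bound (`Sel_str`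
  finite and `ord_p #Sel_str ≤ v_p(coeff₁ Lη)`, as produced by the typed inputs
  `QuadraticBranchOddStrictSelmerBound(OfPlusMC)At`) gives **`n + ord_p #Ш(W)[p^∞] ≤ v_p(coeff₁ Lη)`**
  — the bound controls the LEVEL too, not only `Ш`.
* `level_eq_zero_of_bound_of_unit` / `card_shaPrimary_eq_one_of_bound_of_unit`: with a UNIT
  certificate `coeff₁ Lη ∈ ℤ_p^×`: **`n = 0`** and **`#Ш(W)[p^∞] = 1`**.
* `not_p_divisible_of_oddStrictSelmerBound_of_unit`: END-TO-END over the typed input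
  `QuadraticBranchOddStrictSelmerBoundAt W p` (surjective image) + unit certificate: EVERY generator
  of `W(ℚ)` mod torsion is `p`-INDIVISIBLE in `W(ℚ_p)` (`∀ Q, p • Q ≠ P`), and `Ш(W)[p^∞]` is
  trivial — CONDITIONAL on the typed input; nothing booked.
E1 CONSISTENCY (EVIDENCE pointer, x1b GEN 29 report `class-closure/O10/E1-ETA-BIRCH-2026-08-21.md`
7bad1296deabc496 with the DICT note 158c0dff534a92a1: unit certificate ⟺ `v(a₁ C1) = −1` ⟺ `ν = 0 ∧
p ∤ #Ш_an·Tam`): the 302 B1 rows (unit certificate, two-engine) all have `ν = 0` of record, and the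
51 B2 rows (non-unit) are exactly the rows of record with `ν ≥ 1` or `p ∣ #Ш_an·Tam` — as the
theorems predict GIVEN the typed bound. EVIDENCE only; nothing here is measured anew.

References: [Kobayashi2003] Thm. 4.1 (p. 8), Lemma 9.1 (p. 25); [GreenbergLNM1716] §2 (pp. 62–63);
[KuriharaPollack2007] §1.5 (p. 361); [SilvermanAEC2009] Prop. VII.6.3.
-/

noncomputable section

open scoped Classical MatrixGroups ModularForm

open CongruenceSubgroup WeierstrassCurve Literature.NumberTheory.EllipticCurves
  Literature.NumberTheory.EllipticCurves.ModularForms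
  Literature.NumberTheory.EllipticCurves.Kobayashi2003

namespace Summit.BirchSwinnertonDyer.Rank1Residual.Additive

section NoPTorsion

variable (W : WeierstrassCurve ℚ) [W.IsElliptic] (p : ℕ) [Fact p.Prime]

/-- **`W(ℚ_p)[p] = 0 ⟹ p ∤ #W(ℚ)_tors`** (the standing hypothesis of the η-branch items makes the
`#tors²` term of (C3_η) `p`-adically trivial): `W(ℚ) ↪ W(ℚ_p)` and Cauchy's theorem in the finite
group `W(ℚ)_tors`. [cite: SilvermanAEC2009, VII.3 and VIII.§1] -/
theorem not_dvd_torsionOrder_of_noPTorsion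
    (htors : ∀ Q : (W.baseChange ℚ_[p]).toAffine.Point, p • Q = 0 → Q = 0) :
    ¬ p ∣ W.torsionOrder := by
  -- (`torsionOrder` / `finite_torsion_holds` are general-`K` declarations elaborated with the
  -- classical `DecidableEq`; over `ℚ` we re-instance with `convert` / `congr!`)
  haveI : Finite (AddCommGroup.torsion W.toAffine.Point) := by convert W.finite_torsion_holds
  have hcard : W.torsionOrder = Nat.card (AddCommGroup.torsion W.toAffine.Point) := by
    unfold WeierstrassCurve.torsionOrder
    congr!
  intro hdvd
  rw [hcard] at hdvd
  obtain ⟨T, hT⟩ :=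
    exists_prime_addOrderOf_dvd_card' (G := AddCommGroup.torsion W.toAffine.Point) p hdvd
  have hp1 : p ≠ 1 := (Fact.out : p.Prime).ne_one
  have hpT : p • (T : W.toAffine.Point) = 0 := by
    have h := addOrderOf_nsmul_eq_zero T
    rw [hT] at h
    exact_mod_cast congrArg Subtype.val h
  have hinj : Function.Injective (W.toPadicPoint p) :=
    Affine.Point.map_injective (W' := W) (Algebra.ofId ℚ ℚ_[p])
  have hT0 : (T : W.toAffine.Point) = 0 := by
    apply hinj
    rw [map_zero]
    exact htors _ (by rw [← map_nsmul, hpT, map_zero])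
  have hT1 : addOrderOf T = 1 := by
    rw [show T = 0 from Subtype.ext hT0, addOrderOf_zero]
  exact hp1 (hT.symm.trans hT1)

/-- Hence `ord_p(Tam(W)/#W(ℚ)_tors²) = ord_p Tam(W)` under `W(ℚ_p)[p] = 0` — the (C3_η) exponent
without the torsion term. Bookkeeping. [cite: SilvermanAEC2009, VII.3] -/
theorem padicValRat_tamagawaProduct_div_torsionOrder_sq
    (htors : ∀ Q : (W.baseChange ℚ_[p]).toAffine.Point, p • Q = 0 → Q = 0) :
    padicValRat p ((W.tamagawaProduct : ℚ) / (W.torsionOrder : ℚ) ^ 2) =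
      padicValNat p W.tamagawaProduct := by
  have ht0 : (W.torsionOrder : ℚ) ≠ 0 := by exact_mod_cast W.torsionOrder_pos_holds.ne'
  have hc0 : (W.tamagawaProduct : ℚ) ≠ 0 := by exact_mod_cast W.tamagawaProduct_pos_holds.ne'
  have h0 : padicValNat p W.torsionOrder = 0 :=
    padicValNat.eq_zero_of_not_dvd (not_dvd_torsionOrder_of_noPTorsion W p htors)
  rw [padicValRat.div hc0 (pow_ne_zero 2 ht0), pow_two, padicValRat.mul ht0 ht0, padicValRat.of_nat,
    padicValRat.of_nat, h0]
  simp

end NoPTorsion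

section Level

variable {W : WeierstrassCurve ℚ} [W.IsElliptic] {p : ℕ} [Fact p.Prime]
  {P : W.toAffine.Point} {n : ℕ}

/-- **`Sel_str(W/ℚ)[p^∞]` finite ⟹ `Ш(W)[p^∞]` finite**, at any pair carrying the index data
(generator `P` of exact level `n`, `W(ℚ_p)[p] = 0`): `#Sel_str = pⁿ · #Ш[p^∞]`
(`StrictSha.strictSelmerIndexAt_holds`) and `Nat.card` of a finite non-empty type is `≠ 0`. No GZK,
no analytic rank. [cite: GreenbergLNM1716, §2 (pp. 62–63)] -/
theorem finite_shaPrimary_of_finite_strictSelmerPInfty (hP : ¬ IsOfFinAddOrder P)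
    (hgen : ∀ R : W.toAffine.Point, ∃ (k : ℤ) (T : W.toAffine.Point),
      IsOfFinAddOrder T ∧ R = k • P + T)
    (htors : ∀ Q : (W.baseChange ℚ_[p]).toAffine.Point, p • Q = 0 → Q = 0)
    (hdiv : ∃ Q : (W.baseChange ℚ_[p]).toAffine.Point, p ^ n • Q = W.toPadicPoint p P)
    (hndiv : ∀ Q : (W.baseChange ℚ_[p]).toAffine.Point, p ^ (n + 1) • Q ≠ W.toPadicPoint p P)
    [Finite ↥(strictSelmerPInfty W p)] :
    Finite (AddCommGroup.primaryComponent W.sha p) := by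
  apply Nat.finite_of_card_ne_zero
  intro h0
  have h := StrictSha.strictSelmerIndexAt_holds W p P n hP hgen htors hdiv hndiv
  rw [h0, mul_zero] at h
  exact (Nat.card_pos (α := ↥(strictSelmerPInfty W p))).ne' h

/-- **The bound controls the level: `n + ord_p #Ш(W)[p^∞] ≤ v_p(coeff₁ Lη)`** from the OUTPUT of a
bottom-layer bound (`Sel_str` finite, `ord_p #Sel_str ≤ v_p(coeff₁ Lη)` — the conclusion of the
typed inputs `QuadraticBranchOddStrictSelmerBoundAt` / `…OfPlusMCAt` at a pair) and the index
theorem (`ord_p #Sel_str = n + ord_p #Ш[p^∞]`). [cite: Kobayashi2003, Thm. 4.1 (p. 8) and Lemma 9.1 (p. 25)]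
[cite: GreenbergLNM1716, §2 (pp. 62–63)] -/
theorem level_add_padicValNat_card_sha_le_of_bound {Lη : IwasawaAlgebra p}
    (hB : Finite ↥(strictSelmerPInfty W p) ∧
      (padicValNat p (Nat.card ↥(strictSelmerPInfty W p)) : ℤ) ≤
        ((PowerSeries.coeff 1 Lη : ℤ_[p]) : ℚ_[p]).valuation)
    (hP : ¬ IsOfFinAddOrder P)
    (hgen : ∀ R : W.toAffine.Point, ∃ (k : ℤ) (T : W.toAffine.Point),
      IsOfFinAddOrder T ∧ R = k • P + T)
    (htors : ∀ Q : (W.baseChange ℚ_[p]).toAffine.Point, p • Q = 0 → Q = 0)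
    (hdiv : ∃ Q : (W.baseChange ℚ_[p]).toAffine.Point, p ^ n • Q = W.toPadicPoint p P)
    (hndiv : ∀ Q : (W.baseChange ℚ_[p]).toAffine.Point, p ^ (n + 1) • Q ≠ W.toPadicPoint p P) :
    Finite (AddCommGroup.primaryComponent W.sha p) ∧
      (n : ℤ) + padicValNat p (Nat.card (AddCommGroup.primaryComponent W.sha p)) ≤
        ((PowerSeries.coeff 1 Lη : ℤ_[p]) : ℚ_[p]).valuation := by
  obtain ⟨hfin, hle⟩ := hB
  haveI := hfin
  haveI := finite_shaPrimary_of_finite_strictSelmerPInfty hP hgen htors hdiv hndiv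
  have hI := StrictSha.padicValNat_card_strictSelmerPInfty_eq W p hP hgen htors hdiv hndiv
  refine ⟨inferInstance, ?_⟩
  rw [hI, Nat.cast_add] at hle
  exact hle

/-- **Unit certificate ⟹ level ZERO**: from the bound output and `coeff₁ Lη ∈ ℤ_p^×`, the exact
`p`-divisibility level of the generator in `W(ℚ_p)` is `n = 0`. [cite: Kobayashi2003, Thm. 4.1 (p. 8)]
[cite: GreenbergLNM1716, §2 (pp. 62–63)] -/
theorem level_eq_zero_of_bound_of_unit {Lη : IwasawaAlgebra p}
    (hB : Finite ↥(strictSelmerPInfty W p) ∧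
      (padicValNat p (Nat.card ↥(strictSelmerPInfty W p)) : ℤ) ≤
        ((PowerSeries.coeff 1 Lη : ℤ_[p]) : ℚ_[p]).valuation)
    (hunit : IsUnit (PowerSeries.coeff 1 Lη)) (hP : ¬ IsOfFinAddOrder P)
    (hgen : ∀ R : W.toAffine.Point, ∃ (k : ℤ) (T : W.toAffine.Point),
      IsOfFinAddOrder T ∧ R = k • P + T)
    (htors : ∀ Q : (W.baseChange ℚ_[p]).toAffine.Point, p • Q = 0 → Q = 0)
    (hdiv : ∃ Q : (W.baseChange ℚ_[p]).toAffine.Point, p ^ n • Q = W.toPadicPoint p P)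
    (hndiv : ∀ Q : (W.baseChange ℚ_[p]).toAffine.Point, p ^ (n + 1) • Q ≠ W.toPadicPoint p P) :
    n = 0 ∧ padicValNat p (Nat.card (AddCommGroup.primaryComponent W.sha p)) = 0 := by
  obtain ⟨-, hle⟩ := level_add_padicValNat_card_sha_le_of_bound hB hP hgen htors hdiv hndiv
  obtain ⟨u, hu⟩ := hunit
  rw [← hu, valuation_coe_units_eq_zero p u] at hle
  omega

/-- A finite `p`-primary component of order prime to `p` is trivial: `#Ш(W)[p^∞] = 1` (it is a
`p`-group, so its order is a power of `p`; Mathlib `IsPGroup.iff_card`; general-`A` twin of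
additive-p3's `card_primaryComponent_eq_one_of_padicValNat_eq_zero`, which assumes `Ш` finite). [folklore] -/
theorem natCard_primaryComponent_eq_one_of_padicValNat_eq_zero {A : Type*} [AddCommGroup A]
    [Finite (AddCommGroup.primaryComponent A p)]
    (h : padicValNat p (Nat.card (AddCommGroup.primaryComponent A p)) = 0) :
    Nat.card (AddCommGroup.primaryComponent A p) = 1 := by
  have hp : p.Prime := Fact.out
  have hP : IsPGroup p (Multiplicative (AddCommGroup.primaryComponent A p)) := by
    intro g
    obtain ⟨k, hk⟩ := (AddCommGroup.mem_primaryComponent).1 (Multiplicative.toAdd g).2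
    refine ⟨k, Multiplicative.toAdd.injective ?_⟩
    rw [toAdd_pow, toAdd_one]
    exact Subtype.ext (by simpa using hk)
  obtain ⟨k, hk⟩ := IsPGroup.iff_card.1 hP
  rw [Nat.card_congr Multiplicative.toAdd] at hk
  rw [hk, padicValNat.prime_pow] at h
  rw [hk, h, pow_zero]

/-- **Unit certificate ⟹ `#Ш(W)[p^∞] = 1`** (not only `p ∤ #Ш`): from the bound output, the unit,
and the index data. [cite: Kobayashi2003, Thm. 4.1 (p. 8)] [cite: GreenbergLNM1716, §2 (pp. 62–63)] -/
theorem card_shaPrimary_eq_one_of_bound_of_unit {Lη : IwasawaAlgebra p}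
    (hB : Finite ↥(strictSelmerPInfty W p) ∧
      (padicValNat p (Nat.card ↥(strictSelmerPInfty W p)) : ℤ) ≤
        ((PowerSeries.coeff 1 Lη : ℤ_[p]) : ℚ_[p]).valuation)
    (hunit : IsUnit (PowerSeries.coeff 1 Lη)) (hP : ¬ IsOfFinAddOrder P)
    (hgen : ∀ R : W.toAffine.Point, ∃ (k : ℤ) (T : W.toAffine.Point),
      IsOfFinAddOrder T ∧ R = k • P + T)
    (htors : ∀ Q : (W.baseChange ℚ_[p]).toAffine.Point, p • Q = 0 → Q = 0)
    (hdiv : ∃ Q : (W.baseChange ℚ_[p]).toAffine.Point, p ^ n • Q = W.toPadicPoint p P)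
    (hndiv : ∀ Q : (W.baseChange ℚ_[p]).toAffine.Point, p ^ (n + 1) • Q ≠ W.toPadicPoint p P) :
    Nat.card (AddCommGroup.primaryComponent W.sha p) = 1 := by
  haveI := hB.1
  haveI := finite_shaPrimary_of_finite_strictSelmerPInfty hP hgen htors hdiv hndiv
  exact natCard_primaryComponent_eq_one_of_padicValNat_eq_zero
    (level_eq_zero_of_bound_of_unit hB hunit hP hgen htors hdiv hndiv).2

end Level

/-! ## END-TO-END over the typed input: the generator is `p`-indivisible in `W(ℚ_p)` -/

section Consumers

variable (W : WeierstrassCurve ℚ) [W.IsElliptic] [W.IsGloballyMinimal] (p : ℕ) [Fact p.Prime]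

/-- **END-TO-END, surjective form (CONDITIONAL on the typed input; nothing booked):** granted the
typed bottom-layer bound `QuadraticBranchOddStrictSelmerBoundAt W p` (p259634 §3), at a pair
`(W, p)` with `W^{(p*)} ≅ V` good, `a_p(V) = 0`, `ρ_{V,p^∞}` onto, carrying a UNIT certificate
`coeff₁ L_p⁻(V, η, X) ∈ ℤ_p^×`, and with `W(ℚ_p)[p] = 0`: **every generator `P` of `W(ℚ)` modulo
torsion is `p`-INDIVISIBLE in `W(ℚ_p)`** (`∀ Q, p • Q ≠ P`) **and `#Ш(W)[p^∞] = 1`.** (The level `n`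
of `P` exists by `StrictSha.exists_level_of_not_isOfFinAddOrder`; it is `0` by
`level_eq_zero_of_bound_of_unit`.) No analytic rank, no GZK, no `p`-adic height enters. This is the
sharpening of `bsdp_of_oddStrictSelmerBound_of_unit` by the index theorem: the certificate pins the
LOCAL position of the Mordell–Weil group, a falsifiable E1 prediction (module docstring).
[cite: Kobayashi2003, Thm. 4.1 (p. 8) and Lemma 9.1 (p. 25)] [cite: GreenbergLNM1716, §2 (pp. 62–63)]
[cite: SilvermanAEC2009, Prop. VII.6.3] -/
theorem not_p_divisible_of_oddStrictSelmerBound_of_unit (h : QuadraticBranchOddStrictSelmerBoundAt W p)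
    {V : WeierstrassCurve ℚ} [V.IsElliptic] [V.IsGloballyMinimal] {C : VariableChange ℚ}
    {N : ℕ} [NeZero N] {f : CuspForm (Gamma0 N) 2} {ϖ : ℚ} {Lη : IwasawaAlgebra p}
    (hp : p ≠ 2) (hC : C • W.quadraticTwist ((-1) ^ (p / 2) * p) = V)
    (hgood : V.HasGoodReductionAtPrime p) (hap : V.frobeniusTrace p = 0)
    (hsurj : ∀ m : ℕ, V.HasSurjectiveModNGaloisRep (p ^ m : ℕ)) (hf : IsNewformOf V f)
    (hϖ : if Even (p / 2) then (ϖ : ℝ) * V.realPeriodRat = plusPeriod f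
        else (ϖ : ℝ) * V.imaginaryPeriodRat = minusPeriod f)
    (hL : IsQuadraticBranchMinusLFunction f p ϖ Lη) (hunit : IsUnit (PowerSeries.coeff 1 Lη))
    (htors : ∀ Q : (W.baseChange ℚ_[p]).toAffine.Point, p • Q = 0 → Q = 0)
    {P : W.toAffine.Point} (hP : ¬ IsOfFinAddOrder P)
    (hgen : ∀ R : W.toAffine.Point, ∃ (k : ℤ) (T : W.toAffine.Point),
      IsOfFinAddOrder T ∧ R = k • P + T) :
    (∀ Q : (W.baseChange ℚ_[p]).toAffine.Point, p • Q ≠ W.toPadicPoint p P) ∧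
      Nat.card (AddCommGroup.primaryComponent W.sha p) = 1 := by
  have hB := h V C hp hC hgood hap hsurj hf ϖ hϖ Lη hL hunit.ne_zero
  -- the level of `P` in `W(ℚ_p)`
  obtain ⟨lam, hlam⟩ := exists_addMonoidHom_padicInt_apply_eq_zero_iff p (W.baseChange ℚ_[p])
  have hinj : Function.Injective (W.toPadicPoint p) :=
    Affine.Point.map_injective (W' := W) (Algebra.ofId ℚ ℚ_[p])
  have hPp : ¬ IsOfFinAddOrder (W.toPadicPoint p P) := by
    intro hfin
    apply hP
    obtain ⟨m, hm, hmP⟩ := isOfFinAddOrder_iff_nsmul_eq_zero.mp hfin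
    refine isOfFinAddOrder_iff_nsmul_eq_zero.mpr ⟨m, hm, hinj ?_⟩
    rw [map_nsmul, map_zero]
    exact hmP
  obtain ⟨n, hdiv, hndiv⟩ := StrictSha.exists_level_of_not_isOfFinAddOrder p lam hlam hPp
  obtain ⟨hn0, -⟩ := level_eq_zero_of_bound_of_unit hB hunit hP hgen htors hdiv hndiv
  subst hn0
  refine ⟨fun Q => ?_, card_shaPrimary_eq_one_of_bound_of_unit hB hunit hP hgen htors hdiv hndiv⟩
  have := hndiv Q
  rwa [zero_add, pow_one] at this

/-- **END-TO-END, image-free (main-conjecture) form:** the same over the typed (C1_η)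
`QuadraticBranchPlusMainConjectureAt V p` and `QuadraticBranchOddStrictSelmerBoundOfPlusMCAt W p`
(p259634 §3; for twins whose `p`-adic image is not onto). CONDITIONAL on two typed inputs; by the O10
class lead's ruling NOT an O10 route; nothing booked. [cite: Kobayashi2003, Thm. 7.4 (p. 13) and §4 (p. 8)]
[cite: GreenbergLNM1716, §2 (pp. 62–63)] -/
theorem not_p_divisible_of_oddStrictSelmerBoundOfPlusMC_of_unit
    (h : QuadraticBranchOddStrictSelmerBoundOfPlusMCAt W p)
    {V : WeierstrassCurve ℚ} [V.IsElliptic] [V.IsGloballyMinimal] {C : VariableChange ℚ}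
    {N : ℕ} [NeZero N] {f : CuspForm (Gamma0 N) 2} {ϖ : ℚ} {Lη : IwasawaAlgebra p}
    (hp : p ≠ 2) (hC : C • W.quadraticTwist ((-1) ^ (p / 2) * p) = V)
    (hgood : V.HasGoodReductionAtPrime p) (hap : V.frobeniusTrace p = 0)
    (h1 : QuadraticBranchPlusMainConjectureAt V p) (hf : IsNewformOf V f)
    (hϖ : if Even (p / 2) then (ϖ : ℝ) * V.realPeriodRat = plusPeriod f
        else (ϖ : ℝ) * V.imaginaryPeriodRat = minusPeriod f)
    (hL : IsQuadraticBranchMinusLFunction f p ϖ Lη) (hunit : IsUnit (PowerSeries.coeff 1 Lη))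
    (htors : ∀ Q : (W.baseChange ℚ_[p]).toAffine.Point, p • Q = 0 → Q = 0)
    {P : W.toAffine.Point} (hP : ¬ IsOfFinAddOrder P)
    (hgen : ∀ R : W.toAffine.Point, ∃ (k : ℤ) (T : W.toAffine.Point),
      IsOfFinAddOrder T ∧ R = k • P + T) :
    (∀ Q : (W.baseChange ℚ_[p]).toAffine.Point, p • Q ≠ W.toPadicPoint p P) ∧
      Nat.card (AddCommGroup.primaryComponent W.sha p) = 1 := by
  have hB := h V C hp hC hgood hap h1 hf ϖ hϖ Lη hL hunit.ne_zero
  obtain ⟨lam, hlam⟩ := exists_addMonoidHom_padicInt_apply_eq_zero_iff p (W.baseChange ℚ_[p])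
  have hinj : Function.Injective (W.toPadicPoint p) :=
    Affine.Point.map_injective (W' := W) (Algebra.ofId ℚ ℚ_[p])
  have hPp : ¬ IsOfFinAddOrder (W.toPadicPoint p P) := by
    intro hfin
    apply hP
    obtain ⟨m, hm, hmP⟩ := isOfFinAddOrder_iff_nsmul_eq_zero.mp hfin
    refine isOfFinAddOrder_iff_nsmul_eq_zero.mpr ⟨m, hm, hinj ?_⟩
    rw [map_nsmul, map_zero]
    exact hmP
  obtain ⟨n, hdiv, hndiv⟩ := StrictSha.exists_level_of_not_isOfFinAddOrder p lam hlam hPp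
  obtain ⟨hn0, -⟩ := level_eq_zero_of_bound_of_unit hB hunit hP hgen htors hdiv hndiv
  subst hn0
  refine ⟨fun Q => ?_, card_shaPrimary_eq_one_of_bound_of_unit hB hunit hP hgen htors hdiv hndiv⟩
  have := hndiv Q
  rwa [zero_add, pow_one] at this

end Consumers

end Summit.BirchSwinnertonDyer.Rank1Residual.Additive

end
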